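/-
# GraphEquations — GRAPH RESTRICTION, CANONICAL CORRECTIONS, and the ROW CRITERION (M17e, decomp-mm-lens-5 g30)

(supports `MultiplicityReduction`, stmt-MatrixMultiplication-27806, hand 1 = BOP′ at `K = 2`;
the formal content of the g30 memo §1.2 calibration.)

* GRAPH RESTRICTION `res : ℂ[A,B,C] → ℂ[A,B]`, `res t = (Ψ⁻¹ t)(a,b;0) = t(a,b,ab)` (`graphRestrict`,
  a ring homomorphism; `I = ker res`, `eval_graphRestrict`, `sub_liftAB_graphRestrict_mem`).
* CORRECTIONS ARE CANONICAL (`corr_mem_iff`): for every field `μ` and test `t` there is EXACTLY ONE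
  `ρ ∈ ℂ[A,B]` with `D_μ t − ι ρ ∈ I`, namely `ρ = Σ_q μ_q · r_q(t)` where
  `r_q(t) := res (∂t/∂c_q) = coeff_{F_q} (Ψ⁻¹ t) ∈ ℂ[A,B]` is the `q`-th entry of the JACOBIAN ROW of
  `t` as a polynomial in `(a,b)` (`rowPoly`, `rowPoly_eq_coeff`, `eval_rowPoly`; `ZeroRow t ⟺` all
  `r_q(t) = 0`, `zeroRow_iff_rowPoly`).  So the pair `(μ, ρ)` of M16b's corrected deflation carries
  no freedom in `ρ`: its whole content is the COST of the polynomials `Σ_q μ_q · r_q(t_j)`.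
* ROW CRITERION (`exists_reduced_of_rowCircuits`): for `E` correct with test ideal initially isolated
  to order `2` over `y` there is a tangent `γ` at `y` such that ANY fan-in-two program computing the
  `γ`-paired row polynomials `ι(Σ_q γ_q · r_q(t_j))` of the tests (those that are not `0`) yields a
  CORRECT system REDUCED at the graph point over `y`, of cost `≤ 5·cost E + n² + cost` of that
  program — a CONSTANT field, at the SAME base `y`, with no flatness / twist / row-split hypothesis
  (M16b `deflate_corrected` + M16d `correctedForwardModeAD` + `constSystem` juxtaposed, `juxt`).
* Hence the uniform statement `CheapRowRestriction β β′` («γ-paired Jacobian rows of cheap correct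
  systems restrict cheaply to the graph») IMPLIES the g29/g30 residuals for every `K₀, T₀, s₀` when
  `2 ≤ β′` (`hiddenTwistedCorrDeflation_of_cheapRowRestriction`,
  `unboundedTwistCorrDeflation_of_cheapRowRestriction`) and rung `2` of BOP′ on the window
  (`boundedOrderPurification_two_of_cheapRowRestriction`).  It is STRONGER than those residuals
  (constant field, same base), recorded as the canonical SUFFICIENT form of the hand-1 leaf, not as a
  new residual.
-/
import Mathlib
import Summits.MatrixMultiplication.Statement
import Summits.MatrixMultiplication.MatrixMultiplication.Theorems.GraphEquationsSurgery

open scoped BigOperators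

noncomputable section

set_option linter.dupNamespace false

namespace Summit.MatrixMultiplication.MatrixMultiplication.Theorems.GraphEquations

open MvPolynomial Literature.Computability.AlgebraicComplexity
open Literature.Computability.AlgebraicComplexity.ArithCircuit

variable {n : ℕ}

/-! ## Graph restriction -/

/-- **Graph restriction** `res t = (Ψ⁻¹ t)(a,b;0) = t(a,b,ab) ∈ ℂ[A,B]`. -/
def graphRestrict (n : ℕ) : MvPolynomial (GraphVars n) ℂ →+* MvPolynomial (MatMulVars n) ℂ :=
  (constantCoeff : FPoly n →+* MvPolynomial (MatMulVars n) ℂ).comp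
    (liftF n : MvPolynomial (GraphVars n) ℂ →+* FPoly n)

/-- Unfolding. -/
theorem graphRestrict_apply (t : MvPolynomial (GraphVars n) ℂ) :
    graphRestrict n t = constantCoeff (liftF n t) := rfl

/-- `res (ι g) = g`. -/
@[simp] theorem graphRestrict_liftAB (g : MvPolynomial (MatMulVars n) ℂ) : graphRestrict n (liftAB n g) = g := by
  rw [graphRestrict_apply, liftF_liftAB, constantCoeff_C]

/-- `t ∈ I ⟺ res t = 0`. -/
theorem mem_graphIdeal_iff_graphRestrict (t : MvPolynomial (GraphVars n) ℂ) :
    t ∈ graphIdeal n ↔ graphRestrict n t = 0 :=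
  mem_graphIdeal_iff_constantCoeff_liftF t

/-- `(res t)(y) = t(graphPoint y)`: `res` is restriction to the graph. -/
theorem eval_graphRestrict (y : MatMulVars n → ℂ) (t : MvPolynomial (GraphVars n) ℂ) :
    eval y (graphRestrict n t) = eval (graphPoint y) t := by
  conv_rhs => rw [← substF_liftF t]
  rw [eval_graphPoint_substF, graphRestrict_apply]

/-- `t ≡ ι(res t) (mod I)`. -/
theorem sub_liftAB_graphRestrict_mem (t : MvPolynomial (GraphVars n) ℂ) :
    t - liftAB n (graphRestrict n t) ∈ graphIdeal n := by
  rw [mem_graphIdeal_iff_graphRestrict, map_sub, graphRestrict_liftAB, sub_self]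

/-- Uniqueness: `t − ι ρ ∈ I ⟺ ρ = res t`. -/
theorem sub_liftAB_mem_iff (t : MvPolynomial (GraphVars n) ℂ) (ρ : MvPolynomial (MatMulVars n) ℂ) :
    t - liftAB n ρ ∈ graphIdeal n ↔ ρ = graphRestrict n t := by
  rw [mem_graphIdeal_iff_graphRestrict, map_sub, graphRestrict_liftAB, sub_eq_zero, eq_comm]

/-- `ι g ∈ I ⟺ g = 0` (`ℂ[A,B] ∩ I = 0`). -/
theorem liftAB_mem_graphIdeal_iff (g : MvPolynomial (MatMulVars n) ℂ) : liftAB n g ∈ graphIdeal n ↔ g = 0 := by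
  rw [mem_graphIdeal_iff_graphRestrict, graphRestrict_liftAB]

/-! ## Jacobian rows as polynomials in `(a,b)`; canonical corrections -/

/-- `Ψ⁻¹ ∘ ∂/∂c_q = ∂/∂F_q ∘ Ψ⁻¹`. -/
theorem liftF_pderiv_inr (q : Fin n × Fin n) (t : MvPolynomial (GraphVars n) ℂ) :
    liftF n (pderiv (Sum.inr q) t) = pderiv q (liftF n t) := by
  conv_lhs => rw [← substF_liftF t]
  rw [← substF_pderiv, liftF_substF]

/-- The `q`-th entry of the JACOBIAN ROW of `t` as a polynomial in `(a,b)`: `r_q(t) := res (∂t/∂c_q)`. -/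
def rowPoly (t : MvPolynomial (GraphVars n) ℂ) (q : Fin n × Fin n) : MvPolynomial (MatMulVars n) ℂ :=
  graphRestrict n (pderiv (Sum.inr q) t)

/-- `r_q(t)` is the coefficient of `F_q` in `Ψ⁻¹ t`. -/
theorem rowPoly_eq_coeff (t : MvPolynomial (GraphVars n) ℂ) (q : Fin n × Fin n) :
    rowPoly t q = coeff (Finsupp.single q 1) (liftF n t) := by
  rw [rowPoly, graphRestrict_apply, liftF_pderiv_inr,
    show constantCoeff (pderiv q (liftF n t)) = coeff 0 (pderiv q (liftF n t)) from rfl, coeff_pderiv]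
  simp

/-- `r_q(t)(y)` is the Jacobian entry `(∂t/∂c_q)(graphPoint y)`. -/
theorem eval_rowPoly (y : MatMulVars n → ℂ) (t : MvPolynomial (GraphVars n) ℂ) (q : Fin n × Fin n) :
    eval y (rowPoly t q) = eval (graphPoint y) (pderiv (Sum.inr q) t) :=
  eval_graphRestrict y _

/-- `r_q` is additive in `t`. -/
theorem rowPoly_add (t u : MvPolynomial (GraphVars n) ℂ) (q : Fin n × Fin n) :
    rowPoly (t + u) q = rowPoly t q + rowPoly u q := by
  simp [rowPoly, map_add]

/-- `r_q(0) = 0`. -/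
@[simp] theorem rowPoly_zero (q : Fin n × Fin n) : rowPoly (0 : MvPolynomial (GraphVars n) ℂ) q = 0 := by
  simp [rowPoly]

/-- ZERO ROW ⟺ all row polynomials vanish. -/
theorem zeroRow_iff_rowPoly (t : MvPolynomial (GraphVars n) ℂ) : ZeroRow t ↔ ∀ q, rowPoly t q = 0 := by
  simp only [ZeroRow, rowPoly_eq_coeff]

/-- `res (D_μ t) = Σ_q μ_q · r_q(t)`. -/
theorem graphRestrict_derivC (μ : Fin n × Fin n → MvPolynomial (MatMulVars n) ℂ)
    (t : MvPolynomial (GraphVars n) ℂ) : graphRestrict n (derivC μ t) = ∑ q, μ q * rowPoly t q := by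
  unfold derivC rowPoly
  rw [map_sum]
  exact Finset.sum_congr rfl fun q _ => by rw [map_mul, graphRestrict_liftAB]

/-- **CORRECTIONS ARE CANONICAL.**  `D_μ t − ι ρ ∈ I ⟺ ρ = Σ_q μ_q · r_q(t)`. -/
theorem corr_mem_iff (μ : Fin n × Fin n → MvPolynomial (MatMulVars n) ℂ)
    (t : MvPolynomial (GraphVars n) ℂ) (ρ : MvPolynomial (MatMulVars n) ℂ) :
    derivC μ t - liftAB n ρ ∈ graphIdeal n ↔ ρ = ∑ q, μ q * rowPoly t q := by
  rw [sub_liftAB_mem_iff, graphRestrict_derivC]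

/-- The `γ`-PAIRED ROW of `t` for a constant vector `γ`: `Σ_q γ_q · r_q(t) ∈ ℂ[A,B]`. -/
def pairedRow (γ : Fin n × Fin n → ℂ) (t : MvPolynomial (GraphVars n) ℂ) : MvPolynomial (MatMulVars n) ℂ :=
  ∑ q, C (γ q) * rowPoly t q

/-- `pairedRow γ 0 = 0`. -/
@[simp] theorem pairedRow_zero (γ : Fin n × Fin n → ℂ) : pairedRow γ (0 : MvPolynomial (GraphVars n) ℂ) = 0 := by
  simp [pairedRow]

/-- The canonical corrected test along the constant field `γ` lies in `I`. -/
theorem derivC_const_sub_pairedRow_mem (γ : Fin n × Fin n → ℂ) (t : MvPolynomial (GraphVars n) ℂ) :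
    derivC (fun q => C (γ q)) t - liftAB n (pairedRow γ t) ∈ graphIdeal n :=
  (corr_mem_iff _ t _).mpr rfl

/-- `(pairedRow γ t)(y) = (J-row of t over y) · γ`. -/
theorem eval_pairedRow (γ : Fin n × Fin n → ℂ) (t : MvPolynomial (GraphVars n) ℂ) (y : MatMulVars n → ℂ) :
    eval y (pairedRow γ t) = ∑ q, γ q * eval (graphPoint y) (pderiv (Sum.inr q) t) := by
  simp only [pairedRow, map_sum, map_mul, eval_C, eval_rowPoly]

namespace EqSystem

/-! ## Juxtaposition of two programs -/

/-- The JUXTAPOSITION of two systems: the gates of `F` shifted after those of `E`, both test lists. -/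
def juxt (E F : EqSystem n) : EqSystem n :=
  ⟨⟨E.circuit.gates ++ F.circuit.gates.map (Gate.shift E.cost), E.circuit.output⟩,
    E.tests ++ F.tests.map (· + E.cost)⟩

/-- Cost is additive. -/
theorem juxt_cost (E F : EqSystem n) : (E.juxt F).cost = E.cost + F.cost := by
  simp [juxt, cost, ArithCircuit.size]

/-- Gate values concatenate. -/
theorem juxt_gateValues (E F : EqSystem n) :
    gateValues (E.juxt F).circuit.gates = gateValues E.circuit.gates ++ gateValues F.circuit.gates :=
  gateValues_append_shift _ _

/-- Values of the gates of `E` are unchanged. -/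
theorem juxt_testPoly_left (E F : EqSystem n) {i : ℕ} (hi : i < E.cost) : (E.juxt F).testPoly i = E.testPoly i := by
  unfold testPoly
  rw [juxt_gateValues, List.getD_eq_getElem?_getD, List.getD_eq_getElem?_getD,
    List.getElem?_append_left (by rw [gateValues_length]; exact hi)]

/-- Values of the gates of `F` sit after those of `E`. -/
theorem juxt_testPoly_right (E F : EqSystem n) (i : ℕ) : (E.juxt F).testPoly (i + E.cost) = F.testPoly i := by
  unfold testPoly
  rw [juxt_gateValues, List.getD_append_right _ _ _ _ (by rw [gateValues_length]; exact Nat.le_add_left _ _),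
    gateValues_length]
  simp [cost, ArithCircuit.size]

/-- Fan-in two is preserved. -/
theorem juxt_isFanInTwo {E F : EqSystem n} (hE : E.circuit.IsFanInTwo) (hF : F.circuit.IsFanInTwo) :
    (E.juxt F).circuit.IsFanInTwo := by
  intro g hg
  simp only [juxt, List.mem_append, List.mem_map] at hg
  rcases hg with hg | ⟨g', hg', rfl⟩
  · exact hE g hg
  · rw [Gate.fanIn_shift]; exact hF g' hg'

/-- Tests of `E` are tests of the juxtaposition. -/
theorem mem_juxt_tests_left {E F : EqSystem n} {i : ℕ} (h : i ∈ E.tests) : i ∈ (E.juxt F).tests :=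
  List.mem_append_left _ h

/-- Tests of `F`, shifted, are tests of the juxtaposition. -/
theorem mem_juxt_tests_right {E F : EqSystem n} {i : ℕ} (h : i ∈ F.tests) : i + E.cost ∈ (E.juxt F).tests :=
  List.mem_append_right _ (List.mem_map.mpr ⟨i, h, rfl⟩)

/-! ## The row criterion -/

/-- `Eρ` COMPUTES THE `γ`-PAIRED ROWS of the tests of `E`: every nonzero `ι(pairedRow γ t_j)` is
one of its tests. -/
def ComputesPairedRows (E : EqSystem n) (γ : Fin n × Fin n → ℂ) (Eρ : EqSystem n) : Prop :=
  ∀ j ∈ E.tests, pairedRow γ (E.testPoly j) = 0 ∨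
    ∃ i ∈ Eρ.tests, Eρ.testPoly i = liftAB n (pairedRow γ (E.testPoly j))

/-- **ROW CRITERION.**  For `E` correct with test ideal initially isolated to order `2` over `y`
there is a tangent `γ` at `y` such that every fan-in-two program computing the `γ`-paired rows of
the tests gives a CORRECT system REDUCED at the graph point over `y`, of cost
`≤ 5·cost E + (n² + cost Eρ)` — constant field, same base, no structural hypothesis. -/
theorem exists_reduced_of_rowCircuits {E : EqSystem n} {y : MatMulVars n → ℂ} (hE : E.Correct)
    (hiso : E.IdealInitIsolatedAt 2 y) :
    ∃ γ : Fin n × Fin n → ℂ, (E.jacobianC (graphPoint y)).mulVec γ = 0 ∧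
      ∀ Eρ : EqSystem n, Eρ.circuit.IsFanInTwo → E.ComputesPairedRows γ Eρ →
        ∃ E'' : EqSystem n, E''.Correct ∧ E''.ReducedAt (graphPoint y) ∧
          E''.cost ≤ 5 * E.cost + (n * n + Eρ.cost) := by
  obtain ⟨γ, hγT, hcorr⟩ := hiso.deflate_corrected hE
  refine ⟨γ, hγT, fun Eρ hfanρ hrows => ?_⟩
  set μ : Fin n × Fin n → MvPolynomial (MatMulVars n) ℂ := fun q => C (γ q) with hμdef
  set ρ : ℕ → MvPolynomial (MatMulVars n) ℂ := fun j => pairedRow γ (E.testPoly j) with hρdef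
  set Eμ : EqSystem n := (constSystem γ).juxt Eρ with hEμ
  have hμy : ∀ q, eval y (μ q) = γ q := fun q => eval_C _
  have hfanμ : Eμ.circuit.IsFanInTwo := juxt_isFanInTwo (constSystem_isFanInTwo γ) hfanρ
  have hμ : ∀ q, ∃ i ∈ Eμ.tests, Eμ.testPoly i = liftAB n (μ q) := fun q => by
    have hlt : ((Fintype.equivFin (Fin n × Fin n)) q : ℕ) < (constSystem γ).cost := by
      simpa [constSystem, cost, ArithCircuit.size] using ((Fintype.equivFin (Fin n × Fin n)) q).isLt
    refine ⟨_, mem_juxt_tests_left ?_, by rw [juxt_testPoly_left _ _ hlt, constSystem_testPoly]⟩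
    simp only [constSystem, List.mem_range]
    exact ((Fintype.equivFin (Fin n × Fin n)) q).isLt
  have hρ : ∀ j ∈ E.tests, ρ j = 0 ∨ ∃ i ∈ Eμ.tests, Eμ.testPoly i = liftAB n (ρ j) := fun j hj => by
    rcases hrows j hj with h0 | ⟨i, hi, he⟩
    · exact Or.inl h0
    · exact Or.inr ⟨i + (constSystem γ).cost, mem_juxt_tests_right hi, by rw [juxt_testPoly_right, he]⟩
  have hI : ∀ j ∈ E.tests, derivC μ (E.testPoly j) - liftAB n (ρ j) ∈ graphIdeal n := fun j _ =>
    derivC_const_sub_pairedRow_mem γ _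
  have hρ0 : ∀ j ∈ E.tests, E.testPoly j = 0 → ρ j = 0 := fun j _ h0 => by
    simp only [hρdef, h0, pairedRow_zero]
  obtain ⟨E', hfan', hD, htests, hcost'⟩ := correctedForwardModeAD n E Eμ μ ρ hE.1 hfanμ hμ hρ hρ0
  have hE' : E'.Correct := hE.of_contains hfan' hD.1 fun j' hj' => by
    rcases htests j' hj' with ⟨j, hj, he⟩ | ⟨j, hj, he⟩
    · rw [he]; exact mem_graphIdeal_of_vanishing fun x hx => hE.eval_testPoly_eq_zero hx hj
    · rw [he]; exact hI j hj
  refine ⟨E', hE', reducedAt_of_idealInitIsolatedAt_one hE' (hcorr μ hμy ρ hI E' hD), ?_⟩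
  calc E'.cost ≤ 5 * E.cost + Eμ.cost := hcost'
    _ = 5 * E.cost + (n * n + Eρ.cost) := by rw [hEμ, juxt_cost, constSystem_cost]

/-! ## The uniform sufficient statement -/

/-- **`CheapRowRestriction β β′`** — the canonical SUFFICIENT form of the hand-1 leaf at `K = 2`:
for a correct `E` of cost `≤ c·n^β` and ANY tangent `γ` at ANY base `y`, some fan-in-two program of
cost `≤ c′·n^{β′}` computes the `γ`-paired Jacobian rows `ι(Σ_q γ_q · r_q(t_j))` of the tests
(graph restrictions of the derivatives `D_γ t_j`). -/
def CheapRowRestriction (β β' : ℝ) : Prop :=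
  ∀ c : ℝ, ∃ c' : ℝ, ∀ n : ℕ, 1 ≤ n → ∀ (E : EqSystem n) (y : MatMulVars n → ℂ) (γ : Fin n × Fin n → ℂ),
    E.Correct → (E.jacobianC (graphPoint y)).mulVec γ = 0 → (E.cost : ℝ) ≤ c * (n : ℝ) ^ β →
    ∃ Eρ : EqSystem n, Eρ.circuit.IsFanInTwo ∧ E.ComputesPairedRows γ Eρ ∧ (Eρ.cost : ℝ) ≤ c' * (n : ℝ) ^ β'

/-- `n² ≤ n^{β′}` for `n ≥ 1`, `β′ ≥ 2`. -/
theorem natSq_le_rpow {n : ℕ} (hn : 1 ≤ n) {β' : ℝ} (hβ' : 2 ≤ β') : ((n * n : ℕ) : ℝ) ≤ (n : ℝ) ^ β' := by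
  have h1 : (1 : ℝ) ≤ n := by exact_mod_cast hn
  calc ((n * n : ℕ) : ℝ) = (n : ℝ) ^ (2 : ℝ) := by rw [Real.rpow_two]; push_cast; ring
    _ ≤ (n : ℝ) ^ β' := Real.rpow_le_rpow_of_exponent_le h1 hβ'

/-- **`CheapRowRestriction β β′ ⟹ HiddenTwistedCorrDeflation K₀ β β′`** (every `K₀`; `β′ ≥ 2`):
constant field `γ`, same base, canonical corrections — STRONGER than the g29 residual. -/
theorem hiddenTwistedCorrDeflation_of_cheapRowRestriction {β β' : ℝ} (hβ' : 2 ≤ β')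
    (h : CheapRowRestriction β β') (K₀ : ℕ) : HiddenTwistedCorrDeflation K₀ β β' := by
  intro c
  obtain ⟨c', hc'⟩ := h c
  refine ⟨c' + 1, fun n hn E y hE hiso _ _ _ hcost => ?_⟩
  obtain ⟨γ, hγT, hcorr⟩ := hiso.deflate_corrected hE
  obtain ⟨Eρ, hfanρ, hrows, hρcost⟩ := hc' n hn E y γ hE hγT hcost
  refine ⟨y, fun q => C (γ q), fun j => pairedRow γ (E.testPoly j), (constSystem γ).juxt Eρ,
    juxt_isFanInTwo (constSystem_isFanInTwo γ) hfanρ, fun q => ?_, fun j hj => ?_, ?_,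
    fun j _ => derivC_const_sub_pairedRow_mem γ _, fun E'' hD => hcorr _ (fun q => eval_C _) _
      (fun j _ => derivC_const_sub_pairedRow_mem γ _) E'' hD⟩
  · have hlt : ((Fintype.equivFin (Fin n × Fin n)) q : ℕ) < (constSystem γ).cost := by
      simpa [constSystem, cost, ArithCircuit.size] using ((Fintype.equivFin (Fin n × Fin n)) q).isLt
    refine ⟨_, mem_juxt_tests_left ?_, by rw [juxt_testPoly_left _ _ hlt, constSystem_testPoly]⟩
    simp only [constSystem, List.mem_range]
    exact ((Fintype.equivFin (Fin n × Fin n)) q).isLt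
  · rcases hrows j hj with h0 | ⟨i, hi, he⟩
    · exact Or.inl h0
    · exact Or.inr ⟨i + (constSystem γ).cost, mem_juxt_tests_right hi, by rw [juxt_testPoly_right, he]⟩
  · rw [juxt_cost, constSystem_cost]
    push_cast [Nat.cast_add]
    have hsq := natSq_le_rpow hn hβ'
    push_cast at hsq
    nlinarith [hsq, hρcost]

/-- Hence `CheapRowRestriction β β′ ⟹ UnboundedTwistCorrDeflation K₀ T₀ s₀ β β′` (g30 residual). -/
theorem unboundedTwistCorrDeflation_of_cheapRowRestriction {β β' : ℝ} (hβ' : 2 ≤ β')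
    (h : CheapRowRestriction β β') (K₀ T₀ s₀ : ℕ) : UnboundedTwistCorrDeflation K₀ T₀ s₀ β β' :=
  (hiddenTwistedCorrDeflation_of_cheapRowRestriction hβ' h K₀).unboundedTwist T₀ s₀

/-- **Rung `2` of BOP′ from `CheapRowRestriction` on the window** `2 ≤ β < β′ ≤ ω`. -/
theorem boundedOrderPurification_two_of_cheapRowRestriction
    (hR : ∀ β β' : ℝ, 2 ≤ β → β < β' → β' ≤ omega ℂ → CheapRowRestriction β β')
    (β : ℝ) (hβ : 2 ≤ β) (hiso : EqAdmissibleIdealIso β 2) (β' : ℝ) (hββ' : β < β') :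
    EqAdmissiblePure β' :=
  boundedOrderPurification_two_of_unboundedTwist 0 0 0
    (fun β₁ β₁' h1 h2 h3 =>
      unboundedTwistCorrDeflation_of_cheapRowRestriction (h1.trans h2.le) (hR β₁ β₁' h1 h2 h3) 0 0 0)
    β hβ hiso β' hββ'

end EqSystem

end Summit.MatrixMultiplication.MatrixMultiplication.Theorems.GraphEquations
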